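import Summits.CriticalPhenomena.SAWScalingLimit.Theorems.SAWLoopFugacityFlowAvoidanceLimitShieldGood
import HarnessLib

/-!
# The certified component of the shielding lemma, abstract killed set

Sub-problem `CriticalPhenomena/SAWScalingLimit`, crux `AvoidanceLimit`, line `symplectic-fermion-anchor`
(lead c6, §shield, stub W5b). This is `certified_package` (file `…ShieldGood.lean`) with the germ-region
data (`b, s, g, o`, `germSites`, `germGate`) replaced by an abstract vertex set `Θ ⊆ Ω_δ` that has
no exits inside the maneuver box: every edge of `Ω^δ = discreteDomainGraph D.carrier δ` from a site of
`Θ ∩ mW c k` to a site of `mW c k` ends in `Θ`. Let `λ` be a closed walk of `Ω^δ` (`D` a Jordan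
domain, `δ > 0`) all of whose vertices are sites of `Ω_δ`. Call a site **certified** if it is off
`λ`, the polygon of `λ` winds a nonzero number of times about it, it lies in the box `mW c k` and it
belongs to `Θ`. Then (`certified_package_abstract`):

* every lattice edge at a certified site is an edge of `Ω^δ` (the closed edge lies in the union of
  `D` (rescaled) and the polygon — `segment_subset_of_walkWinding_ne_zero` with the vanishing of the
  winding number off `D`, `wind_walkPath_sub_eq_zero_of_smul_not_mem` — so it is a mesh edge, and
  its far end is a site of `Ω_δ`);
* a lattice neighbour, inside the box, of a certified site is certified or a vertex of `λ` (the
  winding number does not change across a non-edge, `walkWinding_eq_of_adj_of_closed`; the closed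
  edge between two sites off `λ` misses the polygon, `segment_disjoint_range_walkPath_of_adj`, so it
  lies in `D`, it is a kept edge of `Ω^δ` inside the box, and its far end stays in `Θ` by the
  closure hypothesis).

This is the set `S` fed to the lattice core `shieldCore_*` in the abstract shielding lemma
`shield_N_abstract` (corrected Chelkak 2016, Lemma 2.14). All statements are [folklore].

## References

* D. Chelkak, Robust discrete complex analysis: a toolbox, Ann. Probab. 44 (2016), Lemma 2.14.
  [Chelkak2016]
-/

noncomputable section

open scoped BigOperators Classical
open Set Complex SimpleGraph Metric
open Literature.Topology.PlaneTopology
open Literature.Probability.Percolation (walkWinding StepKind stepKind_of_adj)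
open Literature.Probability.LatticeModels
open Literature.Probability.RandomPlanarGeometry (JordanDomain)

namespace Summit.CriticalPhenomena.SAWScalingLimit.Theorems.AvoidanceLimit.Anchor

/-- **The certified sites of the shielding lemma, abstract killed set.** Let `λ` be a closed walk of
`Ω^δ = discreteDomainGraph D.carrier δ` (`D` a Jordan domain, `δ > 0`) all of whose vertices are
sites of `Ω_δ`, and let `Θ ⊆ Ω_δ` have no exits of `Ω^δ` inside the box `mW c k`. Let `S` be the set
of sites `v` off `λ` with `walkWinding λ v ≠ 0`, in the box `mW c k`, that belong to `Θ`. Then every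
lattice edge at a site of `S` is an edge of `Ω^δ`, and a lattice neighbour inside the box of a site
of `S` lies in `S` or on `λ`. [folklore] -/
theorem certified_package_abstract :
    ∀ (D : JordanDomain) (δ : ℝ), 0 < δ → ∀ (Θ : Set (Site 2)), Θ ⊆ meshDomain D.carrier δ →
    ∀ {a : Site 2} (lam : (discreteDomainGraph D.carrier δ).Walk a a) (c : Site 2) (k : ℕ),
      (∀ t ∈ lam.support, t ∈ meshDomain D.carrier δ) →
      (∀ v ∈ Θ, v ∈ mW c k → ∀ e : SRW.Dir 2, (discreteDomainGraph D.carrier δ).Adj v (v + SRW.stepVec e) →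
        v + SRW.stepVec e ∈ mW c k → v + SRW.stepVec e ∈ Θ) →
      ∃ S : Set (Site 2),
        (∀ u : Site 2, u ∉ lam.support →
          walkWinding (lam.mapLe ((discreteDomainGraph_le_meshGraph _ _).trans (meshGraph_le_zdGraph _ _))) u ≠ 0 →
          u ∈ mW c k → u ∈ Θ → u ∈ S) ∧
        S ⊆ Θ ∧ S ⊆ mW c k ∧ (∀ v ∈ S, v ∉ lam.support) ∧
        (∀ v ∈ S, ∀ e : SRW.Dir 2, (discreteDomainGraph D.carrier δ).Adj v (v + SRW.stepVec e)) ∧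
        (∀ v ∈ S, ∀ kk : Fin 4, v + cornerUnit kk ∈ mW c k →
          v + cornerUnit kk ∈ S ∨ v + cornerUnit kk ∈ lam.support) := by
  intro D δ hδ Θ hΘD a lam c k hlam hclosed
  have hle : discreteDomainGraph D.carrier δ ≤ zdGraph 2 :=
    (discreteDomainGraph_le_meshGraph _ _).trans (meshGraph_le_zdGraph _ _)
  set lam' := lam.mapLe hle with hlam'
  have hsupp : lam'.support = lam.support := Walk.support_mapLe_eq_support hle lam
  -- the rescaled polygon lies in the closure of `D`
  have ha : meshPoint δ a ∈ closure D.carrier :=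
    subset_closure (meshDomain_subset_meshVertices _ _ (hlam a (Walk.start_mem_support lam)))
  have hpoly : ∀ z ∈ range (walkPath lam'), (δ : ℂ) * z ∈ closure D.carrier := by
    rw [hlam', walkPath_mapLe]
    exact smul_mem_closure_of_mem_range_walkPath D.carrier δ lam ha
  set K : Set ℂ := {q : ℂ | (δ : ℂ) * q ∉ D.carrier} with hK
  have hKwind : ∀ q ∈ K, q ∉ range (walkPath lam') → wind (fun t => (walkPath lam').extend t - q) = 0 :=
    fun q hq hqr => wind_walkPath_sub_eq_zero_of_smul_not_mem D δ hδ lam' hpoly q hq hqr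
  -- the set
  refine ⟨{v | v ∉ lam.support ∧ walkWinding lam' v ≠ 0 ∧ v ∈ mW c k ∧ v ∈ Θ},
    fun u hu hw huW huΘ => ⟨hu, hw, huW, huΘ⟩, fun v hv => hv.2.2.2, fun v hv => hv.2.2.1, fun v hv => hv.1, ?_, ?_⟩
  · -- every lattice edge at a certified site is an edge of `Ω^δ`
    intro v hv e
    obtain ⟨hvs, hvw, hvW, hvΘ⟩ := hv
    obtain ⟨kk, hkk⟩ := exists_cornerUnit_eq_stepVec e
    rw [← hkk]
    have hvs' : v ∉ lam'.support := by rwa [hsupp]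
    have hseg := segment_subset_of_walkWinding_ne_zero K lam' hKwind v hvs' hvw kk
    -- the mesh segment lies in the closure
    have hsegcl : segment ℝ (meshPoint δ v) (meshPoint δ (v + cornerUnit kk)) ⊆ closure D.carrier := by
      intro Y hY
      obtain ⟨z, hz, rfl⟩ := (mem_segment_meshPoint_iff δ _ _ Y).1 hY
      rcases hseg hz with h | h
      · rw [hK, mem_compl_iff, mem_setOf_eq, not_not] at h
        exact subset_closure h
      · exact hpoly z h
    have hmesh : (meshGraph D.carrier δ).Adj v (v + cornerUnit kk) :=
      meshGraph_adj_iff.2 ⟨zdGraph_adj_add_cornerUnit v kk, hsegcl⟩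
    -- the far end is a site of `Ω_δ`
    have hwD : v + cornerUnit kk ∈ meshDomain D.carrier δ := by
      by_cases hws : v + cornerUnit kk ∈ lam.support
      · exact hlam _ hws
      · have hws' : v + cornerUnit kk ∉ lam'.support := by rwa [hsupp]
        have hpt : Site.toComplex (v + cornerUnit kk) ∈ Kᶜ := by
          rcases hseg (right_mem_segment _ _ _) with h | h
          · exact h
          · exact absurd h (toComplex_not_mem_range_walkPath lam' hws')
        rw [hK, mem_compl_iff, mem_setOf_eq, not_not] at hpt
        exact Literature.Probability.Percolation.mem_meshDomain_of_meshGraph_adj (hΘD hvΘ) hpt hmesh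
    exact discreteDomainGraph_adj_iff.2 ⟨hmesh, hΘD hvΘ, hwD⟩
  · -- a lattice neighbour inside the box is certified or on the loop
    intro v hv kk hwW
    obtain ⟨hvs, hvw, hvW, hvΘ⟩ := hv
    by_cases hws : v + cornerUnit kk ∈ lam.support
    · exact Or.inr hws
    left
    have hvs' : v ∉ lam'.support := by rwa [hsupp]
    have hws' : v + cornerUnit kk ∉ lam'.support := by rwa [hsupp]
    have hadj := zdGraph_adj_add_cornerUnit v kk
    have hww : walkWinding lam' (v + cornerUnit kk) ≠ 0 := by
      rw [← walkWinding_eq_of_adj_of_closed lam' v _ hadj hvs' hws']; exact hvw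
    have hseg := segment_subset_of_walkWinding_ne_zero K lam' hKwind v hvs' hvw kk
    -- the closed edge misses the polygon, hence lies (rescaled) in `D`
    have hsegD : segment ℝ (meshPoint δ v) (meshPoint δ (v + cornerUnit kk)) ⊆ D.carrier := by
      intro Y hY
      obtain ⟨z, hz, rfl⟩ := (mem_segment_meshPoint_iff δ _ _ Y).1 hY
      rcases hseg hz with h | h
      · rw [hK, mem_compl_iff, mem_setOf_eq, not_not] at h; exact h
      · exact absurd h (segment_disjoint_range_walkPath_of_adj lam' v _ hadj hvs' hws' z hz)
    have hwpt : meshPoint δ (v + cornerUnit kk) ∈ D.carrier := hsegD (right_mem_segment _ _ _)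
    have hmesh : (meshGraph D.carrier δ).Adj v (v + cornerUnit kk) :=
      meshGraph_adj_iff.2 ⟨hadj, hsegD.trans subset_closure⟩
    have hwD : v + cornerUnit kk ∈ meshDomain D.carrier δ :=
      Literature.Probability.Percolation.mem_meshDomain_of_meshGraph_adj (hΘD hvΘ) hwpt hmesh
    -- so the edge is a kept edge of `Ω^δ` inside the box, and its far end stays in `Θ`
    have hadjG : (discreteDomainGraph D.carrier δ).Adj v (v + cornerUnit kk) :=
      discreteDomainGraph_adj_iff.2 ⟨hmesh, hΘD hvΘ, hwD⟩
    have hwΘ : v + cornerUnit kk ∈ Θ := by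
      obtain ⟨e, he⟩ := SRW.exists_dir_of_adj hadj
      rw [he] at hadjG hwW ⊢
      exact hclosed v hvΘ hvW e hadjG hwW
    exact ⟨hws, hww, hwW, hwΘ⟩

end Summit.CriticalPhenomena.SAWScalingLimit.Theorems.AvoidanceLimit.Anchor

end
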